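import Mathlib
import Summits.Parity.GeneralizedHardyLittlewood.Theorems.LiouvilleShiftedTablesEHStubDescent
import Summits.Parity.GeneralizedHardyLittlewood.Theorems.LiouvilleShiftedTablesEHStubDescentGraded

/-!
# The descent with log-sparse purity (stub `stub_descentLog` of line `upward-replication-free-factorability`, log-sparse variant, crux `EH`)

The log-sparse form of the descent `…Theorems.EH.Descent.stub_descent`: the inputs `H1`
(low conductors are harmless: `∑_{q ≤ x^θ} E♭_D(x; q) = O(x/(log x)^A)`), `H2` (replication
`E♯_D(x; q) ≤ (p − 1) E♯_D(x; qp) + R(qp, x)` for a prime `p ∤ q`), `H3L` (purity of `E♯` in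
the top window of moduli `m ∈ (x^{1−ε'}, 2x^{1−ε'}]` off an exceptional set `I` with the
LOG-sparse bound `#I ≤ x^{1−ε'}/(log x)^{B'}`, for every `B, B' > 0`) and `H4L` (bad moduli are
harmonically sparse, LINEARLY in `#I`: `∑_{q bad} 1/φ(q) ≤ K · #I · x^{−(1−ε')} (log x)²`) of the
line, taken VERBATIM as hypotheses, imply the Wave0 form
`Literature.NumberTheory.Sieve.ElliottHalberstamConjecture = ∀ θ < 1, EH θ` of the
Elliott–Halberstam conjecture; and, level by level, purity of the single window at one fixed
`ε' > 0` already gives `EH θ` for every `θ < 1 − ε'` (`stub_descentLogGraded`).  No character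
theory and no prime counting happens in this file.

Proof.  Identical to `stub_descent` / `stub_descentGraded` except for the bookkeeping of the bad
moduli.  Fix `θ < 1 − ε'` (so `θ < 1`, `κ = 1 − ε' − θ > 0`); it suffices to treat `A > 0`
(`eh_of_pos`).  Apply `H3L` with `B = A + 2`, `B' = A + 3`: this gives `δ₀, x₀` and, for
`x ≥ x₀`, the set `I` with `#I ≤ X/L^{A+3}`, `X = x^{1−ε'}`, `L = log x`; `H4L` (at `κ > 0`)
gives `K, x₁` and hence the bad-sum bound `K' = K · #I/X · L² ≤ max(K, 0) · L²/L^{A+3}`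
(`harmonic_le_of_card_le`); `H1` (at `θ < 1`) gives `C₀`.  At height `x`: `|Δ| ≤ E♭ + E♯`
(`ciSup_abs_le_ciSup_add`); good/bad split of the moduli `q ≤ x^θ` (`sum_le_of_good_bad`, fed
with this `K'`): replication + purity on the good moduli, the trivial bound
(`ciSup_abs_sub_le_trivial`) + harmonic sparsity on the bad ones; finally
`∑_{q ≤ Q} 1/φ(q) ≤ 4 L²` (`totientInvSum_le_four_mul_log_sq`), `x^θ L² ≤ x/L^A` eventually
(`eventually_rpow_mul_log_pow_le`) and `(xL + x) · max(K,0) · L²/L^{A+3} ≤ 2 max(K,0) · x/L^A`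
(`numeric_bound_log`).  No `x^{−η}` term appears any more.

References: H. Davenport, *Multiplicative Number Theory*, 2nd ed., Springer GTM 74 (1980),
ch. 28 (the Bombieri–Vinogradov bookkeeping); H. L. Montgomery, R. C. Vaughan,
*Multiplicative Number Theory I*, CUP 2007, proof of Corollary 11.17 (the trivial bound).
-/

open Finset Real Filter Asymptotics

namespace Summit.Parity.GeneralizedHardyLittlewood.Theorems.EH.DescentLog

open Literature.NumberTheory.Sieve Literature.NumberTheory.LFunctions
open Summit.Parity.GeneralizedHardyLittlewood.Theorems.EH.Descent
open Summit.Parity.GeneralizedHardyLittlewood.Theorems.EH.DescentGraded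

/-! ### The two numeric facts replacing the `x^{−η}` bookkeeping -/

/-- The bad-sum bound from the log-sparse cardinality bound: if `S ≤ K c/X · L²` and
`0 ≤ c ≤ X/L^{A+3}` with `X, L > 0`, then `S ≤ max(K, 0) · L²/L^{A+3}`. [folklore] -/
theorem harmonic_le_of_card_le {K c X L A S : ℝ} (hX : 0 < X) (hL : 0 < L) (hc0 : 0 ≤ c)
    (hc : c ≤ X / L ^ (A + 3)) (hS : S ≤ K * c / X * L ^ 2) :
    S ≤ max K 0 * (L ^ 2 / L ^ (A + 3)) := by
  have hK : K ≤ max K 0 := le_max_left _ _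
  have hK0 : 0 ≤ max K 0 := le_max_right _ _
  have hLA3 : 0 < L ^ (A + 3) := Real.rpow_pos_of_pos hL _
  calc S ≤ K * c / X * L ^ 2 := hS
    _ ≤ max K 0 * c / X * L ^ 2 := by gcongr
    _ ≤ max K 0 * (X / L ^ (A + 3)) / X * L ^ 2 := by gcongr
    _ = max K 0 * (L ^ 2 / L ^ (A + 3)) := by field_simp

/-- The final comparison of the log-sparse descent: with `Y = x/L^A`, `L ≥ 1`, `x ≥ 1`,
`S ≤ C₀ Y`, `W ≤ 4L²`, `Q ≤ x^θ`, `x^θ L² ≤ Y` imply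
`S + (x/L^{A+2}) W + 3 Q L² + (xL + x) · max(K, 0) L²/L^{A+3} + Q L ≤ (C₀ + 8 + 2 max(K, 0)) Y`
(`L^{A+2} = L^A L²`, `L^{A+3} = L^A L³`, `xL + x ≤ 2xL`). [folklore] -/
theorem numeric_bound_log {x L A θ C₀ K S W : ℝ} {Q : ℕ} (hx : 1 ≤ x) (hL : 1 ≤ L)
    (hS : S ≤ C₀ * (x / L ^ A)) (hW : W ≤ 4 * L ^ 2) (hQ : (Q : ℝ) ≤ x ^ θ)
    (h₁ : x ^ θ * L ^ 2 ≤ x / L ^ A) :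
    S + x / L ^ (A + 2) * W + Q * (3 * L ^ 2) + (x * L + x) * (max K 0 * (L ^ 2 / L ^ (A + 3))) +
        Q * L ≤ (C₀ + 8 + 2 * max K 0) * (x / L ^ A) := by
  have hx0 : 0 < x := by linarith
  have hL0 : 0 < L := by linarith
  have hLA : 0 < L ^ A := Real.rpow_pos_of_pos hL0 A
  set Y := x / L ^ A with hY
  have hY0 : 0 ≤ Y := by positivity
  have hxθ : 0 ≤ x ^ θ := Real.rpow_nonneg hx0.le θ
  have t2 : x / L ^ (A + 2) * W ≤ 4 * Y := by
    have hLA2 : L ^ (A + 2) = L ^ A * L ^ 2 := by rw [Real.rpow_add hL0, Real.rpow_two]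
    have h0 : 0 ≤ x / L ^ (A + 2) := by positivity
    calc x / L ^ (A + 2) * W ≤ x / L ^ (A + 2) * (4 * L ^ 2) := mul_le_mul_of_nonneg_left hW h0
      _ = 4 * Y := by rw [hLA2, hY]; field_simp
  have t3 : (Q : ℝ) * (3 * L ^ 2) ≤ 3 * Y := by
    calc (Q : ℝ) * (3 * L ^ 2) ≤ x ^ θ * (3 * L ^ 2) := by gcongr
      _ = 3 * (x ^ θ * L ^ 2) := by ring
      _ ≤ 3 * Y := by gcongr
  have t4 : (x * L + x) * (max K 0 * (L ^ 2 / L ^ (A + 3))) ≤ 2 * max K 0 * Y := by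
    have hLA3 : L ^ (A + 3) = L ^ A * L ^ 3 := by rw [Real.rpow_add hL0, Real.rpow_ofNat]
    have hL3 : (0 : ℝ) < L ^ 3 := by positivity
    have hK0 : 0 ≤ max K 0 := le_max_right _ _
    have h0 : 0 ≤ max K 0 * (L ^ 2 / L ^ (A + 3)) := by positivity
    have hxL2 : x * L + x ≤ 2 * (x * L) := by nlinarith
    calc (x * L + x) * (max K 0 * (L ^ 2 / L ^ (A + 3)))
        ≤ (2 * (x * L)) * (max K 0 * (L ^ 2 / L ^ (A + 3))) := mul_le_mul_of_nonneg_right hxL2 h0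
      _ = 2 * max K 0 * (x * L ^ 3 / L ^ (A + 3)) := by ring
      _ = 2 * max K 0 * Y := by rw [hLA3, hY, mul_div_mul_right _ _ hL3.ne']
  have t5 : (Q : ℝ) * L ≤ Y := by
    have hLL : L ≤ L ^ 2 := by nlinarith
    calc (Q : ℝ) * L ≤ x ^ θ * L := by gcongr
      _ ≤ x ^ θ * L ^ 2 := by gcongr
      _ ≤ Y := h₁
  linarith

/-! ### The graded stub -/

/-- **Graded descent with log-sparse purity** (the level-by-level form): `H1` (low conductors are
harmless), `H2` (replication) and `H4L` (bad moduli are harmonically sparse, linearly in the size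
of the exceptional set), taken verbatim as hypotheses, together with purity of the single window
of moduli `m ∈ (x^{1−ε'}, 2x^{1−ε'}]` off an exceptional set of size `≤ x^{1−ε'}/(log x)^{B'}`
(for every `B, B' > 0`) at one fixed `ε' > 0`, give `Literature.NumberTheory.Sieve.EH θ` for
every `θ < 1 − ε'`: triangle inequality `|Δ| ≤ E♭ + E♯`, good/bad split of the moduli `q ≤ x^θ`,
replication + purity (with `B = A + 2`, `B' = A + 3`) on the good moduli, the trivial bound +
harmonic sparsity on the bad ones, and the eventual comparison of `x^θ L²` with `x/L^A`.
[cite: DavenportMNT1980, ch. 28] -/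
theorem stub_descentLogGraded :
    (∀ δ₀ : ℝ, 0 < δ₀ → δ₀ < 1 / 2 → ∀ θ : ℝ, θ < 1 → ∀ A : ℝ, 0 < A →
      (fun x : ℝ => ∑ q ∈ Finset.Icc 1 ⌊x ^ θ⌋₊, ⨆ a : (ZMod q)ˣ,
          ‖((Literature.NumberTheory.Sieve.ParityWave0.chebyshevPsiMod q (a : ZMod q) x -
                  x / (Nat.totient q : ℝ) : ℝ) : ℂ) -
              ((Nat.totient q : ℂ))⁻¹ *
                ∑ χ ∈ (Finset.univ : Finset (DirichletCharacter ℂ q)) with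
                    ⌊x ^ (1 / 2 - δ₀)⌋₊ < χ.conductor,
                  χ (a : ZMod q)⁻¹ * Literature.NumberTheory.Sieve.chebyshevPsiChar χ x‖) =O[Filter.atTop]
        fun x : ℝ => x / Real.log x ^ A) →
    (∀ (D : ℕ) (x : ℝ), 1 ≤ x → ∀ q : ℕ, 1 ≤ q → ∀ p : ℕ, p.Prime → ¬ p ∣ q →
      (⨆ a : (ZMod q)ˣ,
          ‖((Nat.totient q : ℂ))⁻¹ *
              ∑ χ ∈ (Finset.univ : Finset (DirichletCharacter ℂ q)) with D < χ.conductor,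
                χ (a : ZMod q)⁻¹ * Literature.NumberTheory.Sieve.chebyshevPsiChar χ x‖) ≤
        ((p : ℝ) - 1) *
            (⨆ a : (ZMod (q * p))ˣ,
              ‖((Nat.totient (q * p) : ℂ))⁻¹ *
                  ∑ χ ∈ (Finset.univ : Finset (DirichletCharacter ℂ (q * p))) with D < χ.conductor,
                    χ (a : ZMod (q * p))⁻¹ * Literature.NumberTheory.Sieve.chebyshevPsiChar χ x‖) +
          Literature.NumberTheory.Sieve.nonCoprimePart (q * p) x) →
    (∀ ε' θ : ℝ, 0 < ε' → 0 < 1 - ε' - θ →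
      ∃ K x₁ : ℝ, ∀ x : ℝ, x₁ ≤ x → ∀ I : Finset ℕ,
        ∀ Bad : Finset ℕ, Bad ⊆ Finset.Icc 1 ⌊x ^ θ⌋₊ →
          (∀ q ∈ Bad, ∀ p : ℕ, p.Prime → ¬ p ∣ q →
              x ^ (1 - ε') / q < p → (p : ℝ) ≤ 2 * x ^ (1 - ε') / q → q * p ∈ I) →
            ∑ q ∈ Bad, ((Nat.totient q : ℝ))⁻¹ ≤
              K * (I.card : ℝ) / x ^ (1 - ε') * Real.log x ^ 2) →
    ∀ ε' : ℝ, 0 < ε' →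
      (∀ B : ℝ, 0 < B → ∀ B' : ℝ, 0 < B' →
        ∃ δ₀ : ℝ, 0 < δ₀ ∧ δ₀ < 1 / 2 ∧ ∃ x₀ : ℝ, ∀ x : ℝ, x₀ ≤ x →
          ∃ I : Finset ℕ, (I.card : ℝ) ≤ x ^ (1 - ε') / Real.log x ^ B' ∧
            ∀ m ∈ Finset.Ioc ⌊x ^ (1 - ε')⌋₊ ⌊2 * x ^ (1 - ε')⌋₊, m ∉ I →
              (⨆ a : (ZMod m)ˣ, ‖((Nat.totient m : ℂ))⁻¹ *
                  ∑ χ ∈ (Finset.univ : Finset (DirichletCharacter ℂ m)) with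
                      ⌊x ^ (1 / 2 - δ₀)⌋₊ < χ.conductor,
                    χ (a : ZMod m)⁻¹ * Literature.NumberTheory.Sieve.chebyshevPsiChar χ x‖) <
                x / ((Nat.totient m : ℝ) * Real.log x ^ B)) →
      ∀ θ : ℝ, θ < 1 - ε' → Literature.NumberTheory.Sieve.EH θ := by
  intro h1 h2 h4 ε' hε h3 θ hθε
  have hθ : θ < 1 := by linarith
  have hκ : 0 < 1 - ε' - θ := by linarith
  refine eh_of_pos θ fun A hA => ?_
  obtain ⟨δ₀, hδ₀, hδ₀', x₀, hpur⟩ := h3 (A + 2) (by linarith) (A + 3) (by linarith)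
  obtain ⟨K, x₁, hbad⟩ := h4 ε' θ hε hκ
  obtain ⟨C₀, hC₀⟩ := (h1 δ₀ hδ₀ hδ₀' θ hθ A hA).bound
  refine IsBigO.of_bound (C₀ + 8 + 2 * max K 0) ?_
  filter_upwards [hC₀, eventually_ge_atTop x₀, eventually_ge_atTop x₁,
    eventually_ge_atTop (2 : ℝ), Real.tendsto_log_atTop.eventually_ge_atTop (1 : ℝ),
    eventually_rpow_mul_log_pow_le 2 A (sub_pos.2 hθ)] with x hC₀x hx₀ hx₁ hx2 hL1 hev1
  have hx1 : (1 : ℝ) ≤ x := by linarith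
  have hx0 : (0 : ℝ) ≤ x := by linarith
  have hL0 : 0 ≤ Real.log x := by linarith
  have hLpos : 0 < Real.log x := by linarith
  have hXpos : 0 < x ^ (1 - ε') := Real.rpow_pos_of_pos (by linarith) _
  have hw : x ^ (1 - ε') ≤ x := by
    calc x ^ (1 - ε') ≤ x ^ (1 : ℝ) := Real.rpow_le_rpow_of_exponent_le hx1 (by linarith)
      _ = x := Real.rpow_one x
  have hxθ : x ^ θ ≤ x := by
    calc x ^ θ ≤ x ^ (1 : ℝ) := Real.rpow_le_rpow_of_exponent_le hx1 hθ.le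
      _ = x := Real.rpow_one x
  obtain ⟨I, hI, hpurx⟩ := hpur x hx₀
  have main := sum_le_of_good_bad (Q := ⌊x ^ θ⌋₊) (I := I) (w := x ^ (1 - ε'))
    (M := Real.log x ^ (A + 2)) (K' := max K 0 * (Real.log x ^ 2 / Real.log x ^ (A + 3)))
    (r := 3 * Real.log x ^ 2) (L := Real.log x) (x := x)
    (T := fun q => ⨆ a : (ZMod q)ˣ, |ParityWave0.chebyshevPsiMod q a x - x / Nat.totient q|)
    (Eb := fun q => ⨆ a : (ZMod q)ˣ,
      ‖((ParityWave0.chebyshevPsiMod q (a : ZMod q) x - x / (Nat.totient q : ℝ) : ℝ) : ℂ) -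
        ((Nat.totient q : ℂ))⁻¹ *
          ∑ χ ∈ (Finset.univ : Finset (DirichletCharacter ℂ q)) with
            ⌊x ^ (1 / 2 - δ₀)⌋₊ < χ.conductor, χ (a : ZMod q)⁻¹ * chebyshevPsiChar χ x‖)
    (Es := fun m => ⨆ a : (ZMod m)ˣ,
      ‖((Nat.totient m : ℂ))⁻¹ *
        ∑ χ ∈ (Finset.univ : Finset (DirichletCharacter ℂ m)) with
          ⌊x ^ (1 / 2 - δ₀)⌋₊ < χ.conductor, χ (a : ZMod m)⁻¹ * chebyshevPsiChar χ x‖)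
    (R := fun m => nonCoprimePart m x)
    hx0 hL0 (Real.rpow_pos_of_pos (by linarith) _) (by positivity)
    (fun q hq => by
      haveI : NeZero q := ⟨by have := (Finset.mem_Icc.1 hq).1; omega⟩
      exact ciSup_abs_le_ciSup_add _ _)
    (fun q hq => ciSup_abs_sub_le_trivial (Finset.mem_Icc.1 hq).1 hx1)
    (fun q _ => Real.iSup_nonneg fun a => norm_nonneg _)
    (fun q hq p hp hpq => h2 _ x hx1 q (Finset.mem_Icc.1 hq).1 p hp hpq)
    (fun m hm hmw => nonCoprimePart_le_three_mul_log_sq hm hx2 (hmw.trans (by linarith)))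
    hpurx (fun Bad hB hBI => harmonic_le_of_card_le hXpos hLpos (Nat.cast_nonneg _) hI
      (hbad x hx₁ I Bad hB hBI))
  rw [Real.norm_of_nonneg (Finset.sum_nonneg fun q _ => Real.iSup_nonneg fun a => abs_nonneg _),
    Real.norm_of_nonneg (div_nonneg hx0 (Real.rpow_nonneg hL0 _))]
  refine main.trans ?_
  have hS := hC₀x
  rw [Real.norm_of_nonneg (Finset.sum_nonneg fun q _ => Real.iSup_nonneg fun a => norm_nonneg _),
    Real.norm_of_nonneg (div_nonneg hx0 (Real.rpow_nonneg hL0 _))] at hS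
  have hQ : (⌊x ^ θ⌋₊ : ℝ) ≤ x ^ θ := Nat.floor_le (Real.rpow_nonneg hx0 _)
  have hev1' : x ^ θ * Real.log x ^ 2 ≤ x / Real.log x ^ A := by
    have h := hev1; rwa [show (1 : ℝ) - (1 - θ) = θ by ring] at h
  exact numeric_bound_log hx1 hL1 hS (totientInvSum_le_four_mul_log_sq (hQ.trans hxθ) hL1) hQ
    hev1'

/-! ### The stub -/

/-- **Descent with log-sparse purity** (stub 5 of the log-sparse variant of the line, the
transfer): the four inputs `H1` (low conductors are harmless), `H2` (replication), `H3L`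
(top-window purity off an exceptional set `I` with `#I ≤ x^{1−ε'}/(log x)^{B'}`, for every
`B, B' > 0`) and `H4L` (bad moduli are harmonically sparse, linearly in `#I`) of the line
`upward-replication-free-factorability`, taken verbatim as hypotheses, imply the Wave0 form
`Literature.NumberTheory.Sieve.ElliottHalberstamConjecture = ∀ θ < 1, EH θ` of the
Elliott–Halberstam conjecture: for `θ < 1` put `ε' = min(1/2, (1−θ)/2)`, so that `ε' ≤ 1/2` and
`θ < 1 − ε'`, and apply the graded form `stub_descentLogGraded`.
[cite: DavenportMNT1980, ch. 28] -/
theorem stub_descentLog :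
    (∀ δ₀ : ℝ, 0 < δ₀ → δ₀ < 1 / 2 → ∀ θ : ℝ, θ < 1 → ∀ A : ℝ, 0 < A →
      (fun x : ℝ => ∑ q ∈ Finset.Icc 1 ⌊x ^ θ⌋₊, ⨆ a : (ZMod q)ˣ,
          ‖((Literature.NumberTheory.Sieve.ParityWave0.chebyshevPsiMod q (a : ZMod q) x -
                  x / (Nat.totient q : ℝ) : ℝ) : ℂ) -
              ((Nat.totient q : ℂ))⁻¹ *
                ∑ χ ∈ (Finset.univ : Finset (DirichletCharacter ℂ q)) with
                    ⌊x ^ (1 / 2 - δ₀)⌋₊ < χ.conductor,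
                  χ (a : ZMod q)⁻¹ * Literature.NumberTheory.Sieve.chebyshevPsiChar χ x‖) =O[Filter.atTop]
        fun x : ℝ => x / Real.log x ^ A) →
    (∀ (D : ℕ) (x : ℝ), 1 ≤ x → ∀ q : ℕ, 1 ≤ q → ∀ p : ℕ, p.Prime → ¬ p ∣ q →
      (⨆ a : (ZMod q)ˣ,
          ‖((Nat.totient q : ℂ))⁻¹ *
              ∑ χ ∈ (Finset.univ : Finset (DirichletCharacter ℂ q)) with D < χ.conductor,
                χ (a : ZMod q)⁻¹ * Literature.NumberTheory.Sieve.chebyshevPsiChar χ x‖) ≤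
        ((p : ℝ) - 1) *
            (⨆ a : (ZMod (q * p))ˣ,
              ‖((Nat.totient (q * p) : ℂ))⁻¹ *
                  ∑ χ ∈ (Finset.univ : Finset (DirichletCharacter ℂ (q * p))) with D < χ.conductor,
                    χ (a : ZMod (q * p))⁻¹ * Literature.NumberTheory.Sieve.chebyshevPsiChar χ x‖) +
          Literature.NumberTheory.Sieve.nonCoprimePart (q * p) x) →
    (∀ ε' : ℝ, 0 < ε' → ε' ≤ 1 / 2 → ∀ B : ℝ, 0 < B → ∀ B' : ℝ, 0 < B' →
      ∃ δ₀ : ℝ, 0 < δ₀ ∧ δ₀ < 1 / 2 ∧ ∃ x₀ : ℝ, ∀ x : ℝ, x₀ ≤ x →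
        ∃ I : Finset ℕ, (I.card : ℝ) ≤ x ^ (1 - ε') / Real.log x ^ B' ∧
          ∀ m ∈ Finset.Ioc ⌊x ^ (1 - ε')⌋₊ ⌊2 * x ^ (1 - ε')⌋₊, m ∉ I →
            (⨆ a : (ZMod m)ˣ,
                ‖((Nat.totient m : ℂ))⁻¹ *
                    ∑ χ ∈ (Finset.univ : Finset (DirichletCharacter ℂ m)) with
                        ⌊x ^ (1 / 2 - δ₀)⌋₊ < χ.conductor,
                      χ (a : ZMod m)⁻¹ * Literature.NumberTheory.Sieve.chebyshevPsiChar χ x‖) <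
              x / ((Nat.totient m : ℝ) * Real.log x ^ B)) →
    (∀ ε' θ : ℝ, 0 < ε' → 0 < 1 - ε' - θ →
      ∃ K x₁ : ℝ, ∀ x : ℝ, x₁ ≤ x → ∀ I : Finset ℕ,
        ∀ Bad : Finset ℕ, Bad ⊆ Finset.Icc 1 ⌊x ^ θ⌋₊ →
          (∀ q ∈ Bad, ∀ p : ℕ, p.Prime → ¬ p ∣ q →
              x ^ (1 - ε') / q < p → (p : ℝ) ≤ 2 * x ^ (1 - ε') / q → q * p ∈ I) →
            ∑ q ∈ Bad, ((Nat.totient q : ℝ))⁻¹ ≤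
              K * (I.card : ℝ) / x ^ (1 - ε') * Real.log x ^ 2) →
    Literature.NumberTheory.Sieve.ElliottHalberstamConjecture := by
  intro h1 h2 h3 h4 θ hθ
  have hε : 0 < min (1 / 2 : ℝ) ((1 - θ) / 2) := lt_min (by norm_num) (by linarith)
  have hε2 : min (1 / 2 : ℝ) ((1 - θ) / 2) ≤ 1 / 2 := min_le_left _ _
  have hθε : θ < 1 - min (1 / 2 : ℝ) ((1 - θ) / 2) := by
    have := min_le_right (1 / 2 : ℝ) ((1 - θ) / 2); linarith
  exact stub_descentLogGraded h1 h2 h4 _ hε (h3 _ hε hε2) θ hθε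

end Summit.Parity.GeneralizedHardyLittlewood.Theorems.EH.DescentLog
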